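import Mathlib
import HarnessLib
import Literature.AlgebraicGeometry.Motives.CrystallineTateClasses
import Literature.AlgebraicGeometry.HodgeTheory.AtiyahClassTraceReal

/-!
# Sketch — crux-ideate stmt-HodgeConjecture-14054 (`HodgeBeyondAnchors`), ideator 1, round 1

First lemmas of the two idea cards, over EXISTING declarations:

* card `ordinary-generic-tate-seeds` (A): the typed shape of "general seeds at one model"
  (`SemiregularSeedSpanAt`), the level-`N` Tate classes (`iterTateClasses`) that Chern characters
  of bundles defined over `𝔽_{p^N}` inhabit, and the NECESSITY half of the closed-point
  factorisation: seeds force the class into the `K`-span of on-the-nose Tate classes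
  (`mem_map_span_tateClasses_of_seedSpan`) — i.e. P2(general) ⇒ "P4-span", so that at a
  `ℚ_p`-point (`k = 𝔽_p`, linear Frobenius) the seed statement FACTORS through the Tate
  conjecture of the special fibre.
* card `principle-b-mod-p-hodge-loci` (B): the Kronecker step of "a `2r`-isoclinic point of the
  mod-`p` Hodge locus is a Tate basepoint": a Weil-number quotient `u = λ/qʳ` that is an algebraic
  integer of absolute value `1` at every complex place is a root of unity
  (`exists_pow_eq_one_of_forall_norm_eq_one`, from Mathlib).
-/

namespace Summit.HodgeConjecture.HodgeConjecture.Cruxes.HodgeBeyondAnchors.IdeatorOneSketch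

open Literature.AlgebraicGeometry.Motives Literature.AlgebraicGeometry.Motives.WittScheme
open scoped Isocrystal

noncomputable section

variable {p : ℕ} [Fact p.Prime] {k : Type} [Field k] [CharP k p] [PerfectRing k p]

/-- Level-`N` crystalline Tate classes `{x | φ^N x = p^{rN} x}` (semilinear `φ` iterated `N`
times). For a bundle `E` on `X_k` defined over `𝔽_{p^N}` one has `chᵣ(E)` here; for `k = 𝔽_p`
and `N = 1` this is the Tate eigenspace of the LINEAR Frobenius of the prime field. -/
def iterTateClasses (C : CrystallineRealization p k) (X : SchemeOver k) (r N : ℕ) :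
    Set (C.obj X (2 * r)) :=
  {x | (C.frobK X (2 * r))^[N] x = ((p : K(p, k)) ^ (r * N)) • x}

theorem mem_iterTateClasses_iff (C : CrystallineRealization p k) (X : SchemeOver k) (r N : ℕ)
    (x : C.obj X (2 * r)) :
    x ∈ iterTateClasses C X r N ↔ (C.frobK X (2 * r))^[N] x = ((p : K(p, k)) ^ (r * N)) • x :=
  Iff.rfl

/-- On-the-nose Tate classes (`N = 1`) are exactly level-`1` classes. -/
theorem mem_iterTateClasses_one_iff (C : CrystallineRealization p k) (X : SchemeOver k) (r : ℕ)
    (x : C.obj X (2 * r)) :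
    x ∈ iterTateClasses C X r 1 ↔ x ∈ C.tateClasses X r := by
  rw [mem_iterTateClasses_iff, CrystallineRealization.mem_tateClasses_iff]
  simp

/-- **P2(general) at ONE model, typed** (card A, the statement the crux is "to be restated as"):
the de Rham class `α ∈ H²ʳ_dR(X_K/K)` of the generic fibre of the `W(k)`-model `𝒳` lies in the
`K`-span of the Berthelot–Ogus images of `chᵣ^cris` of finitely many finite locally free,
`{0,1}`-semiregular seeds on the special fibre satisfying the Bloch–Esnault–Kerz Hodge condition at
`𝒳` (no Lefschetz / "already algebraic" hatch: refuters' M3 objection to stmt-1805). -/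
def SemiregularSeedSpanAt (C : CrystallineRealization p k) (𝒳 : SchemeOver (WittVector p k))
    (r : ℕ) (α : C.dR.obj (genericFibre 𝒳) (2 * r)) : Prop :=
  ∃ s : Finset (specialFibre 𝒳).left.Modules,
    (∀ E ∈ s, ∃ hE : IsFiniteLocallyFree E,
        Literature.AlgebraicGeometry.HodgeTheory.IsZeroOneSemiregular hE ∧ C.HodgeCondition 𝒳 E) ∧
    α ∈ Submodule.span K(p, k)
      ((fun E => C.bo 𝒳 (2 * r) (C.chCris (specialFibre 𝒳) E r)) '' (s : Set _))

/-- **Seeds force the class into the span of Tate classes** (necessity half of the closed-point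
factorisation of card A): if `α` is seed-spanned at a smooth proper model then
`α ∈ bo (K·Tate(X_k))`. With `k = 𝔽_p` (a Cassels `ℚ_p`-point of the integral Hodge-locus model)
`Tate(X_k)` is the eigenspace of the LINEAR Frobenius, so P2(general) at such a point factors
through "`bo⁻¹ α` is spanned by Tate classes of a variety over the prime field" — Tate-conjecture
input, free at the anchors, the content of P4 beyond them. -/
theorem mem_map_span_tateClasses_of_seedSpan (C : CrystallineRealization p k) {n : ℕ}
    {𝒳 : SchemeOver (WittVector p k)} (h𝒳 : IsSmoothProperModel n 𝒳) {r : ℕ}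
    {α : C.dR.obj (genericFibre 𝒳) (2 * r)} (h : SemiregularSeedSpanAt C 𝒳 r α) :
    α ∈ (Submodule.span K(p, k) (C.tateClasses (specialFibre 𝒳) r : Set _)).map
      (C.bo 𝒳 (2 * r)) := by
  obtain ⟨s, -, hα⟩ := h
  refine (Submodule.span_le.mpr ?_) hα
  rintro _ ⟨E, -, rfl⟩
  refine Submodule.mem_map_of_mem (Submodule.subset_span ?_)
  exact C.frobK_chCris h𝒳.isSmoothProjective_specialFibre E r

/-- **Engine output at one model** (card A, assembly at a closed point): if `α` is
seed-spanned at the smooth proper model `𝒳` and every seed LIFTS TO `𝒳` (the route's engine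
P1b → P1a → P3a: `{0,1}`-semiregular + Hodge condition ⇒ `LiftsFormally` ⇒ `LiftsTo`), then `α`
lies in the `K`-span of `ℚ`-algebraic de Rham classes of the generic fibre `X_K` — the input of
the descent step P3 (`K ↪ ℂ`). Proof from the tree's axioms `bo_chCris`, `chCris_congr`,
`chDR_mem_ratAlgebraicClasses`. -/
theorem mem_span_ratAlgebraicClasses_of_seedSpan_of_liftsTo (C : CrystallineRealization p k)
    {n : ℕ} {𝒳 : SchemeOver (WittVector p k)} (h𝒳 : IsSmoothProperModel n 𝒳) {r : ℕ}
    {α : C.dR.obj (genericFibre 𝒳) (2 * r)} (h : SemiregularSeedSpanAt C 𝒳 r α)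
    (hlift : ∀ (E : (specialFibre 𝒳).left.Modules) (hE : IsFiniteLocallyFree E),
      Literature.AlgebraicGeometry.HodgeTheory.IsZeroOneSemiregular hE → C.HodgeCondition 𝒳 E →
        LiftsTo 𝒳 E) :
    α ∈ Submodule.span K(p, k)
      (C.dR.ratAlgebraicClasses (genericFibre 𝒳) r : Set (C.dR.obj (genericFibre 𝒳) (2 * r))) := by
  obtain ⟨s, hs, hα⟩ := h
  refine (Submodule.span_le.mpr ?_) hα
  rintro _ ⟨E, hEs, rfl⟩
  obtain ⟨hE, hsr, hH⟩ := hs E hEs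
  obtain ⟨E', hE', ⟨e⟩⟩ := hlift E hE hsr hH
  refine Submodule.subset_span ?_
  show C.bo 𝒳 (2 * r) (C.chCris (specialFibre 𝒳) E r) ∈
    (C.dR.ratAlgebraicClasses (genericFibre 𝒳) r : Set (C.dR.obj (genericFibre 𝒳) (2 * r)))
  rw [← C.chCris_congr e r, C.bo_chCris h𝒳 E' hE' r]
  exact C.chDR_mem_ratAlgebraicClasses h𝒳.isSmoothProjective_genericFibre _ r

/-- **Kronecker step of "isoclinic points are Tate basepoints"** (card B): an algebraic integer
of a number field all of whose complex conjugates have absolute value `1` is a root of unity.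
Applied to `u = λ/qʳ` for a Frobenius eigenvalue `λ` on `H²ʳ` of a `2r`-isoclinic reduction
(slope `r` at every `𝔭 ∣ p`, `ℓ`-adic unit elsewhere, weight `2r` at infinity), it says every
class of `H²ʳ` is Tate after a finite extension, so Ogus's Principle B (4.12) may be run from
that closed point. -/
theorem exists_pow_eq_one_of_forall_norm_eq_one {K : Type*} [Field K] [NumberField K] {u : K}
    (hu : IsIntegral ℤ u) (h : ∀ φ : K →+* ℂ, ‖φ u‖ = 1) : ∃ n : ℕ, 0 < n ∧ u ^ n = 1 := by
  obtain ⟨n, hn, h1⟩ := NumberField.Embeddings.pow_eq_one_of_norm_eq_one K ℂ hu h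
  exact ⟨n, hn, h1⟩

end

end Summit.HodgeConjecture.HodgeConjecture.Cruxes.HodgeBeyondAnchors.IdeatorOneSketch
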